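import Summits.Ventures.HodgeRepro2.T5SU11IwasawaProjection
import Summits.Ventures.HodgeRepro2.T5SU11CartanProjection

/-!
# The spherical functions `φ_λ(g) = ∫_K e^{λ t(k g)} dk` of `SU(1,1)`: bi-`K`-invariant, `φ_λ(a_t) = ∫_K |cosh t - ū² sinh t|^{-λ} dk`

With the Iwasawa `A`-projection `t(g)` of `T5SU11IwasawaProjection` (`e^{t(g)} = |a - b̄|^{-1}` for
`g = su11 a b`) and the probability Haar measure `dk` of `K` (`T5HaarCircle.haarCircle`), Harish-Chandra's
spherical function of parameter `λ ∈ ℝ` is `sph λ g := ∫_K e^{λ t(k g)} dk`. It is BI-`K`-INVARIANT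
(`sph_rot_mul`: the left invariance of `dk` on the abelian `K`; `sph_mul_rot`: the right-`K`-invariance
of `t`), normalised by `sph λ 1 = 1` (`sph_one`), and on `A` it is the classical integral
**`φ_λ(a_t) = ∫_K |cosh t - ū² sinh t|^{-λ} dk`** (`sph_hyp`: `e^{t(k a_t)} = |cosh t - ū² sinh t|^{-1}`,
`exp_iwasawaT_rot_mul_hyp`), so that by the Cartan decomposition `sph λ g = sph λ (a_{cartanT g})`
(`sph_eq_sph_hyp_cartanT`) — the spherical function is a function of the Cartan parameter alone.
Nothing is claimed about (N).

Blind lane: Mathlib + the HodgeRepro2 prefix only; no sorry; axioms ⊆ {propext, Classical.choice,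
Quot.sound}.
-/

namespace Summit.Ventures.HodgeRepro2.T5SU11SphericalFunction

open MeasureTheory MeasureTheory.Measure Metric Set Complex
open T5PoincareDensity T5SU11Unimodular T5SU11Fibration T5SU11Cartan T5SU11OneParameter
  T5BergmanCoefficient T5SU11FibrationCocycle T5SU11KProjection T5SU11IwasawaProjection
  T5SU11CartanProjection T5HaarCircle T5SU11IwasawaMeasure T5SU11UnipotentSubgroup
open scoped Real

/-! ### `e^{t(k a_t)}` in closed form -/

/-- `(rot u · a_t)₀₀ = u cosh t` and `(rot u · a_t)₀₁ = u sinh t`. -/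
lemma mat_rot_mul_hyp (u : Circle) (t : ℝ) :
    mat (rot u * hyp t) = su11 ((u : ℂ) * Real.cosh t) ((u : ℂ) * Real.sinh t) := by
  rw [mat_mul, show mat (rot u) = su11 (u : ℂ) 0 from coe_rot u, mat_hyp, su11_mul]
  simp only [add_zero, Complex.conj_ofReal, zero_mul]

/-- **`e^{t(rot u · a_t)} = |cosh t - ū² sinh t|^{-1}`**: the Iwasawa `A`-part of `k a_t`. -/
theorem exp_iwasawaT_rot_mul_hyp (u : Circle) (t : ℝ) :
    Real.exp (iwasawaT (rot u * hyp t)) =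
      ‖(Real.cosh t : ℂ) - (starRingEnd ℂ) (u : ℂ) ^ 2 * Real.sinh t‖⁻¹ := by
  rw [exp_iwasawaT, mat_rot_mul_hyp]
  show ‖(u : ℂ) * Real.cosh t - (starRingEnd ℂ) ((u : ℂ) * Real.sinh t)‖⁻¹ = _
  have hu : (u : ℂ) * (starRingEnd ℂ) (u : ℂ) = 1 := by
    rw [Complex.mul_conj, Complex.normSq_eq_norm_sq, Circle.norm_coe, one_pow, Complex.ofReal_one]
  have e : (u : ℂ) * Real.cosh t - (starRingEnd ℂ) ((u : ℂ) * Real.sinh t) =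
      (u : ℂ) * ((Real.cosh t : ℂ) - (starRingEnd ℂ) (u : ℂ) ^ 2 * Real.sinh t) := by
    rw [map_mul, Complex.conj_ofReal]
    linear_combination ((starRingEnd ℂ) (u : ℂ) * (Real.sinh t : ℂ)) * hu
  rw [e, norm_mul, Circle.norm_coe, one_mul]

/-- `Ψ(0, 1) = 1`. -/
lemma iwasawa_zero_one : iwasawa (0, 1) = 1 := by
  rw [iwasawa_apply, Complex.zero_re, Complex.zero_im, unip_zero, hyp_zero, map_one, mul_one, mul_one]

/-- `t(1) = 0`. -/
lemma iwasawaT_one : iwasawaT 1 = 0 := by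
  have := iwasawaT_iwasawa 0 1
  rwa [iwasawa_zero_one, Complex.zero_im] at this

/-- `t(rot u) = 0`. -/
lemma iwasawaT_rot (u : Circle) : iwasawaT (rot u) = 0 := by
  rw [← one_mul (rot u), iwasawaT_mul_rot, iwasawaT_one]

/-! ### The spherical functions -/

section measure

variable [MeasurableSpace Circle] [BorelSpace Circle]

/-- **Harish-Chandra's spherical function** of parameter `λ`: `sph λ g = ∫_K e^{λ t(k g)} dk`, with
`t` the Iwasawa `A`-projection and `dk` the probability Haar measure of `K`. -/
noncomputable def sph (lam : ℝ) (g : SU11) : ℝ :=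
  ∫ u, Real.exp (lam * iwasawaT (rot u * g)) ∂haarCircle

/-- **Left `K`-invariance**: `sph λ (rot v · g) = sph λ g`. -/
theorem sph_rot_mul (lam : ℝ) (v : Circle) (g : SU11) : sph lam (rot v * g) = sph lam g := by
  unfold sph
  have h : ∀ u : Circle, rot u * (rot v * g) = rot (v * u) * g := by
    intro u
    rw [← mul_assoc, ← map_mul, mul_comm u v]
  simp_rw [h]
  exact integral_mul_left_eq_self (fun w => Real.exp (lam * iwasawaT (rot w * g))) v

omit [BorelSpace Circle] in
/-- **Right `K`-invariance**: `sph λ (g · rot w) = sph λ g`. -/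
theorem sph_mul_rot (lam : ℝ) (g : SU11) (w : Circle) : sph lam (g * rot w) = sph lam g := by
  unfold sph
  simp_rw [← mul_assoc, iwasawaT_mul_rot]

/-- **Bi-`K`-invariance**: `sph λ (rot u · g · rot v) = sph λ g`. -/
theorem sph_rot_mul_rot (lam : ℝ) (u v : Circle) (g : SU11) :
    sph lam (rot u * g * rot v) = sph lam g := by
  rw [sph_mul_rot, sph_rot_mul]

/-- **Normalisation**: `sph λ 1 = 1`. -/
theorem sph_one (lam : ℝ) : sph lam 1 = 1 := by
  unfold sph
  simp_rw [mul_one, iwasawaT_rot, mul_zero, Real.exp_zero]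
  rw [integral_const, measureReal_def, haarCircle_univ, ENNReal.toReal_one, one_smul]

omit [BorelSpace Circle] in
/-- **The spherical function on `A`**: `sph λ (a_t) = ∫_K |cosh t - ū² sinh t|^{-λ} dk`. -/
theorem sph_hyp (lam t : ℝ) :
    sph lam (hyp t) =
      ∫ u, ‖(Real.cosh t : ℂ) - (starRingEnd ℂ) (u : ℂ) ^ 2 * Real.sinh t‖ ^ (-lam) ∂haarCircle := by
  unfold sph
  congr 1
  funext u
  have hpos : 0 < ‖(Real.cosh t : ℂ) - (starRingEnd ℂ) (u : ℂ) ^ 2 * Real.sinh t‖ := by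
    have h := exp_iwasawaT_rot_mul_hyp u t
    have := Real.exp_pos (iwasawaT (rot u * hyp t))
    rw [h] at this
    exact inv_pos.mp this
  rw [mul_comm, Real.exp_mul, exp_iwasawaT_rot_mul_hyp, Real.inv_rpow hpos.le, ← Real.rpow_neg hpos.le]

/-- **The spherical function is a function of the Cartan parameter**: `sph λ g = sph λ (a_{cartanT g})`. -/
theorem sph_eq_sph_hyp_cartanT (lam : ℝ) (g : SU11) : sph lam g = sph lam (hyp (cartanT g)) := by
  obtain ⟨u, v, hg⟩ := exists_cartan_eq g
  conv_lhs => rw [hg]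
  exact sph_rot_mul_rot lam u v _

end measure

end Summit.Ventures.HodgeRepro2.T5SU11SphericalFunction
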